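import Summits.BirchSwinnertonDyer.BirchSwinnertonDyer.Theorems.PrintCFramBottomClassIndexLawFiveLeSelmerDevissageCount
import Mathlib.GroupTheory.PGroup
import HarnessLib

/-!
# Route `PrintCFram`, crux C2 `BottomClassIndexLawFiveLe` (stmt-BirchSwinnertonDyer-20372), line
# `eisenstein-resource-bdp-line` (registry v18, stub B1 `stub_bsdp_of_classFactor`): **THE DÉVISSAGE COUNT, II —
# the ALIGNED / TRANSVERSE dichotomy at one distinguished subgroup `D`**
# (cell `bsd-print-cfram`, width seat `bsd-line-cfram-p1-w2` g9; helper `--supports` 20372; 0 defs, 0 facts, 0 sorry)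

HONEST FRAMING. Nothing about BSD is proved here, and nothing of any stub; continuous group cohomology in degree one
plus finite group theory, sequel of `…SelmerDevissageCount` (same binders `G`, `S, M, Q`, `ι`, `π`). LEAD g10's «two
lines in a plane» (report `Lines/eisenstein-resource-bdp-line-lead-g10.md` §2(a)) as a theorem: when the classes of
`C ≤ H¹(G, M)` restrict at `D` into ONE line (`#C ≤ p · #(C ∩ ker res_D)`, `M` killed by the prime `p`) and `Q^D = 0`,
EITHER that line lies in the image of `H¹(D, S)` — then the QUOTIENT side of the dévissage count is STRICT at `D`
(ALIGNED) — OR it meets it trivially — then the SUB side is strict at `D` (TRANSVERSE). In the application (companion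
`…SelmerDevissageCountRational`): `G = Γ_ℚ`, `M = W[p]`, `S = Φ` the rational line, `C = Sel_p(W/ℚ)`, `D = D_p`, the
line is the local Kummer condition `W(ℚ_p)/p` (`W(ℚ_p)[p] = 0`), and of the pair `{W, W/Φ}` exactly one is aligned.

* `eq_or_eq_of_card_le_prime_mul` — in an additive group killed by the prime `p`, a chain `C' ≤ C_al ≤ C` with `C`
  finite and `#C ≤ p · #C'` has `C_al = C` or `C_al = C'` (both indices are powers of `p`, `IsPGroup.iff_card`).
* **`aligned_or_transverse`** — `D ≤ G` with `Q^D = 0`, `M` killed by `p`, `C ≤ H¹(G, M)` finite with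
  `#C ≤ p · #(C ∩ ker res_D)`: EITHER every push-forward `π ∘ z`, `[z] ∈ C`, is a coboundary on `D`, OR every
  `w : G → S` with `[ι ∘ w] ∈ C` is a coboundary on `D`. (The classes `c ∈ C` with `π_* c` a coboundary on `D` form a
  subgroup `C_al` between `C ∩ ker res_D` and `C`; `C_al = C` is ALIGNED; if `C_al = C ∩ ker res_D` then `[ι ∘ w] ∈ C`
  lies in it (`π ∘ ι = 0`), so `ι ∘ w`, hence `w` (`Q^D = 0`), is a coboundary on `D`.)

THEOREMS ONLY; no definition, no named fact, no `sorry`. BSD is not proved by any of this; no summit statement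
is proved by this seat. References: [SerreGaloisCohomology1997] I.§2.6 (b), I.§5.1; Greenberg, LNM 1716 (1999) §3;
the LEAD g10 report §2(a); seat notes w2g8 §4.
-/

set_option autoImplicit false
-- `…BirchSwinnertonDyer.BirchSwinnertonDyer.Theorems…` is the problem's mandated namespace (D-0017).
set_option linter.dupNamespace false

noncomputable section

open scoped Classical

namespace Summit.BirchSwinnertonDyer.BirchSwinnertonDyer.Theorems.PrintCFram.SelmerCount

open Literature.NumberTheory.EllipticCurves Literature.NumberTheory.GaloisRepresentations
open Summit.BirchSwinnertonDyer.BirchSwinnertonDyer.Theorems.PrintCFram.LevelDictionary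

universe u

/-! ## §1 No room between `C'` and `C` when `[C : C'] ≤ p` -/

section Algebra

variable {B : Type*} [AddCommGroup B]

/-- **No room between `C'` and `C` when `[C : C'] ≤ p`.** In an additive group in which `p • b = 0` for a prime
`p`, let `C' ≤ C_al ≤ C` be subgroups with `C` finite and `#C ≤ p · #C'`. Then `C_al = C` or `C_al = C'`: both
indices `[C : C_al]`, `[C_al : C']` are powers of `p` (the quotients are killed by `p`) with product `≤ p`.
[folklore] -/
theorem eq_or_eq_of_card_le_prime_mul {p : ℕ} [hp : Fact p.Prime] (hB : ∀ b : B, p • b = 0)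
    {C' Cal C : AddSubgroup B} (h1 : C' ≤ Cal) (h2 : Cal ≤ C) [Finite C]
    (hcard : Nat.card C ≤ p * Nat.card C') : Cal = C ∨ Cal = C' := by
  haveI : Finite Cal := Finite.of_injective _ (AddSubgroup.inclusion_injective h2)
  haveI : Finite C' := Finite.of_injective _ (AddSubgroup.inclusion_injective h1)
  -- the index of `H ≤ K` is a power of `p`
  have hpow : ∀ {H K : AddSubgroup B} (hHK : H ≤ K) [Finite K],
      ∃ n : ℕ, Nat.card K = p ^ n * Nat.card H := by
    intro H K hHK _
    have hP : IsPGroup p (Multiplicative (K ⧸ H.addSubgroupOf K)) := by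
      intro x
      refine ⟨1, ?_⟩
      rw [pow_one]
      obtain ⟨k, hk⟩ := QuotientAddGroup.mk_surjective (Multiplicative.toAdd x)
      have hk0 : p • k = 0 := Subtype.ext (by
        rw [AddSubmonoidClass.coe_nsmul, ZeroMemClass.coe_zero]; exact hB _)
      have hq : p • (QuotientAddGroup.mk k : K ⧸ H.addSubgroupOf K) = 0 := by
        rw [← QuotientAddGroup.mk_nsmul, hk0, QuotientAddGroup.mk_zero]
      rw [← ofAdd_toAdd x, ← ofAdd_nsmul, ← hk, hq, ofAdd_zero]
    haveI : Finite (K ⧸ H.addSubgroupOf K) :=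
      Finite.of_surjective _ (QuotientAddGroup.mk_surjective (s := H.addSubgroupOf K))
    obtain ⟨n, hn⟩ := IsPGroup.iff_card.mp hP
    rw [Nat.card_congr Multiplicative.toAdd] at hn
    refine ⟨n, ?_⟩
    rw [AddSubgroup.card_eq_card_quotient_mul_card_addSubgroup (H.addSubgroupOf K),
      Nat.card_congr (AddSubgroup.addSubgroupOfEquivOfLe hHK).toEquiv, hn]
  obtain ⟨n, hn⟩ := hpow h2
  obtain ⟨m, hm⟩ := hpow h1
  have hC'pos : 0 < Nat.card C' := Nat.card_pos
  have hCalpos : 0 < Nat.card Cal := Nat.card_pos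
  have hle : p ^ (n + m) ≤ p := by
    have h : p ^ (n + m) * Nat.card C' ≤ p * Nat.card C' := by
      rw [pow_add, mul_assoc, ← hm, ← hn]; exact hcard
    exact Nat.le_of_mul_le_mul_right h hC'pos
  have hnm : n + m ≤ 1 := by
    by_contra h
    have h2 : p ^ 2 ≤ p ^ (n + m) := Nat.pow_le_pow_right hp.out.pos (not_le.mp h)
    have hp2 : p ^ 1 < p ^ 2 := Nat.pow_lt_pow_right hp.out.one_lt (by norm_num)
    rw [pow_one] at hp2
    exact absurd (h2.trans hle) (not_le.mpr hp2)
  rcases Nat.eq_zero_or_pos n with hn0 | hn0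
  · -- `[C : C_al] = 1`
    left
    rw [hn0, pow_zero, one_mul] at hn
    exact AddSubgroup.eq_of_le_of_card_ge h2 hn.le
  · -- then `m = 0`: `[C_al : C'] = 1`
    right
    have hm0 : m = 0 := by omega
    rw [hm0, pow_zero, one_mul] at hm
    exact (AddSubgroup.eq_of_le_of_card_ge h1 hm.le).symm

end Algebra

/-! ## §2 The dichotomy at a distinguished subgroup: ALIGNED or TRANSVERSE -/

section Dichotomy

variable {G : Type u} [Group G] [TopologicalSpace G] [IsTopologicalGroup G]
variable {S M Q : Type u} [AddCommGroup S] [AddCommGroup M] [AddCommGroup Q]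
  [DistribMulAction G S] [DistribMulAction G M] [DistribMulAction G Q]
  [TopologicalSpace S] [DiscreteTopology S] [TopologicalSpace M] [DiscreteTopology M]
  [TopologicalSpace Q] [DiscreteTopology Q]

/-- **ALIGNED OR TRANSVERSE** («two lines in a plane», LEAD g10 report §2(a)). `G`, `S, M, Q`, `ι`, `π` as in
`natCard_le_of_devissage`; `M` killed by the prime `p`; `D ≤ G` a subgroup with `Q^D = 0`; `C ≤ H¹(G, M)` a
FINITE subgroup with `#C ≤ p · #(C ∩ ker res_D)` (the classes of `C` restrict into ONE line of `H¹(D, M)`).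
Then EITHER (ALIGNED) for every `z` with `[z] ∈ C` the push-forward `π ∘ z` is a coboundary on `D`, OR
(TRANSVERSE) every `w : G → S` with `[ι ∘ w] ∈ C` is a coboundary on `D`. PROOF: the classes `c ∈ C` with `π_* c`
a coboundary on `D` form a subgroup `C_al` between `C' = C ∩ ker res_D` and `C`; by §1 `C_al = C` (aligned) or
`C_al = C'`; in the latter case `[ι ∘ w] ∈ C` lies in `C_al = C'` (`π ∘ ι = 0`), so `ι ∘ w` is a coboundary on `D`,
hence so is `w` (`Q^D = 0`). [cite: SerreGaloisCohomology1997, I.§2.6 (b) and I.§5.1] -/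
theorem aligned_or_transverse {p : ℕ} [Fact p.Prime]
    (ι : S →+ M) (π : M →+ Q)
    (hι : ∀ (g : G) (s : S), ι (g • s) = g • ι s) (hπ : ∀ (g : G) (m : M), π (g • m) = g • π m)
    (hιinj : Function.Injective ι) (hπι : ∀ s, π (ι s) = 0) (hker : ∀ m, π m = 0 → ∃ s, ι s = m)
    (hpM : ∀ m : M, p • m = 0)
    (D : Subgroup G) (hQD : ∀ q : Q, (∀ g ∈ D, g • q = q) → q = 0)
    (C : AddSubgroup (discreteH1 G M)) [Finite C]
    (hline : Nat.card C ≤ p * Nat.card ↥(C ⊓ subgroupResKer M D)) :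
    (∀ z : contOneCocycles (discreteTopRep G M), oneCocycleClass _ z ∈ C →
        ∃ q : Q, ∀ g ∈ D, π (z.1 g) = g • q - q) ∨
      ∀ w : contOneCocycles (discreteTopRep G S),
        oneCocycleClass (discreteTopRep G M) (contOneCocycles.pullback (ContinuousMonoidHom.id G)
          (resHomOfEquivariant (ContinuousMonoidHom.id G) ι hι) w) ∈ C →
        ∃ s : S, ∀ g ∈ D, w.1 g = g • s - s := by
  -- `H¹(G, M)` is killed by `p`
  have hpH : ∀ b : discreteH1 G M, p • b = 0 := by
    intro b
    obtain ⟨z, rfl⟩ := oneCocycleClass_surjective _ b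
    have hpz : p • z = 0 := Subtype.ext (ContinuousMap.ext fun g ↦ by
      change p • z.1 g = 0
      exact hpM _)
    have h := map_nsmul (oneCocycleClassₗ (discreteTopRep G M)) p z
    rw [oneCocycleClassₗ_apply, oneCocycleClassₗ_apply, hpz, oneCocycleClass_zero] at h
    exact h.symm
  -- the induced map `π_*` on `H¹` and the aligned subgroup
  let πH : discreteH1 G M →+ discreteH1 G Q :=
    (ContinuousCohomology.map (ContinuousMonoidHom.id G)
      (resHomOfEquivariant (ContinuousMonoidHom.id G) π hπ) 1).hom.toLinearMap.toAddMonoidHom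
  have hπH : ∀ z, πH (oneCocycleClass _ z) = oneCocycleClass (discreteTopRep G Q)
      (contOneCocycles.pullback (ContinuousMonoidHom.id G)
        (resHomOfEquivariant (ContinuousMonoidHom.id G) π hπ) z) := fun z ↦
    map_oneCocycleClass _ _ _ z
  let Cal : AddSubgroup (discreteH1 G M) := C ⊓ (subgroupResKer Q D).comap πH
  have h1 : C ⊓ subgroupResKer M D ≤ Cal := by
    intro c hc
    rw [AddSubgroup.mem_inf] at hc
    obtain ⟨hcC, hcD⟩ := hc
    refine AddSubgroup.mem_inf.mpr ⟨hcC, ?_⟩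
    obtain ⟨z, rfl⟩ := oneCocycleClass_surjective _ c
    rw [AddSubgroup.mem_comap, hπH, oneCocycleClass_mem_subgroupResKer_iff]
    obtain ⟨v, hv⟩ := (oneCocycleClass_mem_subgroupResKer_iff D z).1 hcD
    exact ⟨π v, fun σ ↦ by rw [pullback_id_apply, hv σ, map_sub, hπ]⟩
  have h2 : Cal ≤ C := fun c hc ↦ (AddSubgroup.mem_inf.mp hc).1
  rcases eq_or_eq_of_card_le_prime_mul hpH h1 h2 hline with hal | htr
  · -- ALIGNED
    left
    intro z hz
    have hz' : oneCocycleClass _ z ∈ Cal := by rw [hal]; exact hz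
    have hzD := (AddSubgroup.mem_inf.mp hz').2
    rw [AddSubgroup.mem_comap, hπH, oneCocycleClass_mem_subgroupResKer_iff] at hzD
    obtain ⟨q, hq⟩ := hzD
    exact ⟨q, fun g hg ↦ hq ⟨g, hg⟩⟩
  · -- TRANSVERSE
    right
    intro w hw
    set zw := contOneCocycles.pullback (ContinuousMonoidHom.id G)
      (resHomOfEquivariant (ContinuousMonoidHom.id G) ι hι) w with hzw
    have hzw_apply : ∀ g, zw.1 g = ι (w.1 g) := fun g ↦ rfl
    -- `[ι ∘ w] ∈ C_al` since `π ∘ ι ∘ w = 0`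
    have hmem : oneCocycleClass _ zw ∈ Cal := by
      refine AddSubgroup.mem_inf.mpr ⟨hw, ?_⟩
      rw [AddSubgroup.mem_comap, hπH, oneCocycleClass_mem_subgroupResKer_iff]
      exact ⟨0, fun σ ↦ by rw [pullback_id_apply, hzw_apply, hπι, smul_zero, sub_zero]⟩
    rw [htr] at hmem
    obtain ⟨v, hv⟩ := (oneCocycleClass_mem_subgroupResKer_iff D zw).1 (AddSubgroup.mem_inf.mp hmem).2
    exact exists_eq_smul_sub_on_of_incl_principal ι π hι hπ hιinj hπι hker D hQD w.1
      (m₀ := v) fun g hg ↦ by rw [← hzw_apply]; exact hv ⟨g, hg⟩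

end Dichotomy

end Summit.BirchSwinnertonDyer.BirchSwinnertonDyer.Theorems.PrintCFram.SelmerCount

end
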